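import Mathlib
import HarnessLib
import Literature.Probability.LatticeModels.ProductMeasureTools
import Summits.Ventures.LatticeQCDFlow.Exactness.LatticeCoordAvg

/-!
# The block tensorization floor for the free energy of a local log-weight on a finite product of compact probability spaces: `∫F dπ + log ∫e^{−F} dπ ≥ Σ_j (∫h_j dπ + log ∫e^{−A_C h_j} dπ) − 2δ`

HONEST FRAMING: exact (Metropolis-corrected) sampling algorithms for lattice gauge theory;
figures of merit are autocorrelation/cost numbers at stated couplings and volumes; no
continuum-physics claim.

Venture `LatticeQCDFlow` (cell pub-lqcd), topic `Exactness`; FANOUT row 7 (`s0-cpn-null`: the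
S0-D1 rung — 2D CP⁹, Lüscher's LO trivializing map inside HMC, Engel–Schaefer 2011).  NEW WORK of
the cell over Mathlib, the tree's `Exactness/LatticeCoordAvg.lean` (the coordinate averages
`A_s G(ω) = ∫ G(ω' on s, ω off s) dπ(ω')`, `E[A_s G] = E[G]`) and the Literature support lemma
`Literature.Probability.LatticeModels.integral_mul_eq_of_dependsOn_disjoint` ([folklore]: functions of
disjoint coordinate blocks of a product probability measure are uncorrelated — REUSED, not restated);
nothing is cited as a fact.  The argument is the standard conditional-Jensen / tensorization device
([folklore]; e.g. the first step of every proof that the free energy of a lattice system is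
extensive); it is the BARRIER DIRECTION companion of this lineage's McDiarmid-type volume law
(`Exactness/LatticeBoundedDifferences.lean`: `log ∫e^{−(F−∫F)} ≤ ΣD_k²/8`): here the same quantity —
the reverse relative entropy `KL(π ‖ π.tilted(−F)) = ∫F dπ + log ∫e^{−F} dπ` of a sampler whose
proposal is `π` and whose log-weight is `−F` — is bounded BELOW by a sum over SEPARATED BLOCKS of
one-block free-energy fluctuations, each nonnegative and positive as soon as the block's conditional
log-weight is non-constant (`Exactness/CenteredExponentialMomentFloor.lean`).  The instance for the
exact leading-order trivializing flow of the lattice CP(N−1)/O(N) action is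
`Exactness/SphereLOFlowEntropyFloor.lean`.

## Setting

`ι` finite; `X` a compact metric space with its Borel σ-algebra and a probability measure `μ`;
`π = ⊗_ι μ` on `ι → X`; `A_s = coordAvg μ s` (integrate out the coordinates in `s`).  Blocks: a finite
family `B_j` (`j ∈ T`) of pairwise disjoint finite sets of coordinates; `C` a further finite set of
coordinates (the "corridors", to be integrated out).  Local log-weight: `F_loc = Σ_{j∈T} h_j + r` with
`h_j` continuous depending only on `B_j ∪ C` and `r` continuous depending only on `C`; `F` continuous
with `|F − F_loc| ≤ δ` pointwise.

## Content

* §1 LOCALITY OF COORDINATE AVERAGES: `dependsOn_coordAvg` (`G` depends on `R` ⇒ `A_s G` depends on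
  `R ∖ s`), `coordAvg_eq_integral_of_dependsOn` (`R ⊆ s` ⇒ `A_s G ≡ ∫G dπ`), `coordAvg_add`,
  `coordAvg_finset_sum`.
* §2 CONDITIONAL JENSEN FOR THE EXPONENTIAL: **`exp_neg_coordAvg_le`** (`e^{−A_s G} ≤ A_s e^{−G}`
  pointwise, tangent line), **`integral_exp_neg_coordAvg_le`** (`∫e^{−A_s G} dπ ≤ ∫e^{−G} dπ`).
* §3 INDEPENDENCE OF DISJOINT BLOCKS: `dependsOn_finset_prod`,
  **`integral_finset_prod_eq_prod_integral`** (`∫ Π_j k_j dπ = Π_j ∫ k_j dπ` for continuous `k_j`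
  depending on pairwise disjoint blocks).
* §4 **`sum_blocks_le_integral_add_log_integral_exp_neg`** — THE BLOCK TENSORIZATION FLOOR, exact
  form: `Σ_{j∈T} (∫h_j dπ + log ∫e^{−A_C h_j} dπ) ≤ ∫F_loc dπ + log ∫e^{−F_loc} dπ`; and
  **`sum_blocks_sub_le_integral_add_log_integral_exp_neg`** — the approximate form with `− 2δ` for
  any continuous `F` with `|F − F_loc| ≤ δ`.  Each summand equals `log ∫ e^{−(A_C h_j − ∫A_C h_j)} dπ ≥ 0`
  (`integral_add_log_integral_exp_neg_coordAvg_eq`, `integral_add_log_integral_exp_neg_nonneg`):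
  the free energy of an (approximately) local log-weight is at least the SUM of the block free-energy
  fluctuations — linear in the number of blocks when these are bounded below uniformly.

NOT CLAIMED: any lower bound on an individual block term (model input; see
`CenteredExponentialMomentFloor` for `≥ log(1 + (∫|A_C h_j − ∫h_j|)²/8)`); non-product reference
measures; the `L²` (non-continuous) generality.
-/

noncomputable section

namespace Summit.Ventures.LatticeQCDFlow.Exactness

open MeasureTheory Function Set

variable {ι : Type*} [Fintype ι] [DecidableEq ι]
variable {X : Type*} [MeasurableSpace X] [MetricSpace X] [CompactSpace X] [BorelSpace X]
variable (μ : Measure X) [IsProbabilityMeasure μ]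

/-! ## §1 Locality of coordinate averages -/

section Locality

omit [MetricSpace X] [CompactSpace X] [BorelSpace X] [IsProbabilityMeasure μ] in
/-- **`A_s` removes the `s`-coordinates from the dependence set**: if `G` depends only on the
coordinates in `R`, then `A_s G` depends only on those in `R ∖ s`. -/
theorem dependsOn_coordAvg (s : Finset ι) {G : (ι → X) → ℝ} {R : Set ι} (hG : DependsOn G R) :
    DependsOn (coordAvg μ s G) (R \ ↑s) := by
  intro ω₁ ω₂ h
  unfold coordAvg
  congr 1
  funext ω'
  apply hG
  intro i hi
  by_cases his : i ∈ s
  · rw [Finset.piecewise_eq_of_mem _ _ _ his, Finset.piecewise_eq_of_mem _ _ _ his]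
  · rw [Finset.piecewise_eq_of_notMem _ _ _ his, Finset.piecewise_eq_of_notMem _ _ _ his]
    exact h i ⟨hi, fun h' => his (Finset.mem_coe.1 h')⟩

omit [MetricSpace X] [CompactSpace X] [BorelSpace X] [IsProbabilityMeasure μ] in
/-- **If `G` depends only on coordinates inside `s`, then `A_s G` is the constant `∫G dπ`.** -/
theorem coordAvg_eq_integral_of_dependsOn (s : Finset ι) {G : (ι → X) → ℝ} {R : Set ι}
    (hG : DependsOn G R) (hR : R ⊆ ↑s) (ω : ι → X) :
    coordAvg μ s G ω = ∫ ω', G ω' ∂Measure.pi (fun _ : ι => μ) := by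
  unfold coordAvg
  congr 1
  funext ω'
  apply hG
  intro i hi
  rw [Finset.piecewise_eq_of_mem _ _ _ (hR hi)]

/-- `A_s` is additive (continuous integrands). -/
theorem coordAvg_add (s : Finset ι) {G H : (ι → X) → ℝ} (hG : Continuous G) (hH : Continuous H)
    (ω : ι → X) :
    coordAvg μ s (fun ω => G ω + H ω) ω = coordAvg μ s G ω + coordAvg μ s H ω := by
  unfold coordAvg
  have hc : Continuous fun ω' : ι → X => s.piecewise ω' ω :=
    (continuous_piecewise_prod s).comp (Continuous.prodMk_right ω)
  exact integral_add (integrable_pi_of_continuous μ (hG.comp hc))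
    (integrable_pi_of_continuous μ (hH.comp hc))

/-- `A_s` commutes with finite sums (continuous integrands). -/
theorem coordAvg_finset_sum {J : Type*} (T : Finset J) (s : Finset ι) {h : J → (ι → X) → ℝ}
    (hc : ∀ j ∈ T, Continuous (h j)) (ω : ι → X) :
    coordAvg μ s (fun ω => ∑ j ∈ T, h j ω) ω = ∑ j ∈ T, coordAvg μ s (h j) ω := by
  unfold coordAvg
  have hcs : Continuous fun ω' : ι → X => s.piecewise ω' ω :=
    (continuous_piecewise_prod s).comp (Continuous.prodMk_right ω)
  exact integral_finsetSum T fun j hj => integrable_pi_of_continuous μ ((hc j hj).comp hcs)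

end Locality

/-! ## §2 Conditional Jensen for the exponential -/

section Jensen

/-- **`e^{−A_s G(ω)} ≤ A_s(e^{−G})(ω)`** (Jensen for the inner average, by the tangent line of the
exponential at `A_s G(ω)`). -/
theorem exp_neg_coordAvg_le (s : Finset ι) {G : (ι → X) → ℝ} (hG : Continuous G) (ω : ι → X) :
    Real.exp (-coordAvg μ s G ω) ≤ coordAvg μ s (fun ω => Real.exp (-G ω)) ω := by
  have hcs : Continuous fun ω' : ι → X => s.piecewise ω' ω :=
    (continuous_piecewise_prod s).comp (Continuous.prodMk_right ω)
  have hc : Continuous fun ω' : ι → X => G (s.piecewise ω' ω) := hG.comp hcs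
  have hi : Integrable (fun ω' => G (s.piecewise ω' ω)) (Measure.pi fun _ : ι => μ) :=
    integrable_pi_of_continuous μ hc
  have hie : Integrable (fun ω' => Real.exp (-G (s.piecewise ω' ω))) (Measure.pi fun _ : ι => μ) :=
    integrable_pi_of_continuous μ (Real.continuous_exp.comp hc.neg)
  set a : ℝ := coordAvg μ s G ω with ha
  have ha' : ∫ ω', G (s.piecewise ω' ω) ∂Measure.pi (fun _ : ι => μ) = a := by
    rw [ha]; rfl
  have h1 : Integrable (fun _ : ι → X => (1 + a : ℝ)) (Measure.pi fun _ : ι => μ) := integrable_const _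
  have hlin_int : Integrable (fun ω' => Real.exp (-a) * (1 + a - G (s.piecewise ω' ω)))
      (Measure.pi fun _ : ι => μ) := (h1.sub hi).const_mul _
  have hmono : ∫ ω', Real.exp (-a) * (1 + a - G (s.piecewise ω' ω)) ∂Measure.pi (fun _ : ι => μ) ≤
      ∫ ω', Real.exp (-G (s.piecewise ω' ω)) ∂Measure.pi (fun _ : ι => μ) := by
    refine integral_mono hlin_int hie fun ω' => ?_
    have h := Real.add_one_le_exp (a - G (s.piecewise ω' ω))
    calc Real.exp (-a) * (1 + a - G (s.piecewise ω' ω))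
        ≤ Real.exp (-a) * Real.exp (a - G (s.piecewise ω' ω)) :=
          mul_le_mul_of_nonneg_left (by linarith) (Real.exp_pos _).le
      _ = Real.exp (-G (s.piecewise ω' ω)) := by rw [← Real.exp_add]; congr 1; ring
  have hlhs : ∫ ω', Real.exp (-a) * (1 + a - G (s.piecewise ω' ω)) ∂Measure.pi (fun _ : ι => μ) =
      Real.exp (-a) := by
    rw [integral_const_mul, integral_sub h1 hi, integral_const, smul_eq_mul, probReal_univ, one_mul,
      ha']
    ring
  change Real.exp (-a) ≤ ∫ ω', Real.exp (-G (s.piecewise ω' ω)) ∂Measure.pi (fun _ : ι => μ)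
  rw [← hlhs]
  exact hmono

/-- **CONDITIONAL JENSEN, integrated: `∫ e^{−A_s G} dπ ≤ ∫ e^{−G} dπ`** — integrating out coordinates
inside the exponent can only decrease the exponential moment. -/
theorem integral_exp_neg_coordAvg_le (s : Finset ι) {G : (ι → X) → ℝ} (hG : Continuous G) :
    ∫ ω, Real.exp (-coordAvg μ s G ω) ∂Measure.pi (fun _ : ι => μ) ≤
      ∫ ω, Real.exp (-G ω) ∂Measure.pi (fun _ : ι => μ) := by
  have hA : Continuous (coordAvg μ s G) := continuous_coordAvg μ s hG
  have hE : Continuous fun ω : ι → X => Real.exp (-G ω) := Real.continuous_exp.comp hG.neg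
  calc ∫ ω, Real.exp (-coordAvg μ s G ω) ∂Measure.pi (fun _ : ι => μ)
      ≤ ∫ ω, coordAvg μ s (fun ω => Real.exp (-G ω)) ω ∂Measure.pi (fun _ : ι => μ) :=
        integral_mono (integrable_pi_of_continuous μ (Real.continuous_exp.comp hA.neg))
          (integrable_pi_of_continuous μ (continuous_coordAvg μ s hE))
          fun ω => exp_neg_coordAvg_le μ s hG ω
    _ = ∫ ω, Real.exp (-G ω) ∂Measure.pi (fun _ : ι => μ) := integral_coordAvg μ s hE

end Jensen

/-! ## §3 Independence of disjoint blocks -/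

section Blocks

omit [Fintype ι] [DecidableEq ι] [MeasurableSpace X] [MetricSpace X] [CompactSpace X] [BorelSpace X] in
/-- A finite product of block functions depends only on the union of the blocks. -/
theorem dependsOn_finset_prod {J : Type*} (T : Finset J) (B : J → Finset ι)
    {k : J → (ι → X) → ℝ} (hdep : ∀ j ∈ T, DependsOn (k j) ↑(B j)) :
    DependsOn (fun ω => ∏ j ∈ T, k j ω) (⋃ j ∈ T, (↑(B j) : Set ι)) := by
  intro ω₁ ω₂ h
  exact Finset.prod_congr rfl fun j hj => hdep j hj fun i hi => h i (mem_biUnion hj hi)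

/-- **`∫ Π_{j∈T} k_j dπ = Π_{j∈T} ∫ k_j dπ`** for continuous `k_j` depending on pairwise disjoint blocks
`B_j` — the blocks of a product measure are independent. -/
theorem integral_finset_prod_eq_prod_integral {J : Type*} (T : Finset J) (B : J → Finset ι)
    (hB : ∀ j ∈ T, ∀ j' ∈ T, j ≠ j' → Disjoint (B j) (B j'))
    {k : J → (ι → X) → ℝ} (hc : ∀ j ∈ T, Continuous (k j)) (hdep : ∀ j ∈ T, DependsOn (k j) ↑(B j)) :
    ∫ ω, ∏ j ∈ T, k j ω ∂Measure.pi (fun _ : ι => μ) =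
      ∏ j ∈ T, ∫ ω, k j ω ∂Measure.pi (fun _ : ι => μ) := by
  classical
  induction T using Finset.induction_on with
  | empty => simp
  | @insert a T haT ih =>
    have hB' : ∀ j ∈ T, ∀ j' ∈ T, j ≠ j' → Disjoint (B j) (B j') :=
      fun j hj j' hj' hne => hB j (Finset.mem_insert_of_mem hj) j' (Finset.mem_insert_of_mem hj') hne
    have hc' : ∀ j ∈ T, Continuous (k j) := fun j hj => hc j (Finset.mem_insert_of_mem hj)
    have hdep' : ∀ j ∈ T, DependsOn (k j) ↑(B j) := fun j hj => hdep j (Finset.mem_insert_of_mem hj)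
    simp only [Finset.prod_insert haT]
    rw [← ih hB' hc' hdep']
    -- independence of `k a` (block `B a`) from the product over `T` (block `T.biUnion B`)
    have hdisj : Disjoint (B a) (T.biUnion B) := by
      rw [Finset.disjoint_biUnion_right]
      intro j hj
      exact hB a (Finset.mem_insert_self a T) j (Finset.mem_insert_of_mem hj)
        (fun h => haT (h ▸ hj))
    have hFm : Measurable (k a) := (hc a (Finset.mem_insert_self a T)).measurable
    have hGc : Continuous fun ω : ι → X => ∏ j ∈ T, k j ω :=
      continuous_finsetProd T fun j hj => hc' j hj
    have hGdep : DependsOn (fun ω : ι → X => ∏ j ∈ T, k j ω) ↑(T.biUnion B) := by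
      rw [Finset.coe_biUnion]
      exact dependsOn_finset_prod T B hdep'
    rw [← Measure.infinitePi_eq_pi]
    exact Literature.Probability.LatticeModels.integral_mul_eq_of_dependsOn_disjoint (fun _ : ι => μ)
      hdisj hFm hGc.measurable (hdep a (Finset.mem_insert_self a T)) hGdep

end Blocks

/-! ## §4 The block tensorization floor -/

section Floor

omit [DecidableEq ι] in
/-- `∫K dπ + log ∫e^{−K} dπ = log ∫ e^{−(K − ∫K dπ)} dπ` (continuous `K`): the free energy of the
log-weight `−K` relative to `π` is the log exponential moment of the centred `K`. -/
theorem integral_add_log_integral_exp_neg_eq {K : (ι → X) → ℝ} (hK : Continuous K) :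
    (∫ ω, K ω ∂Measure.pi (fun _ : ι => μ)) +
        Real.log (∫ ω, Real.exp (-K ω) ∂Measure.pi (fun _ : ι => μ)) =
      Real.log (∫ ω, Real.exp (-(K ω - ∫ ω', K ω' ∂Measure.pi (fun _ : ι => μ)))
        ∂Measure.pi (fun _ : ι => μ)) := by
  set m : ℝ := ∫ ω', K ω' ∂Measure.pi (fun _ : ι => μ) with hm
  have e : ∀ ω, Real.exp (-(K ω - m)) = Real.exp m * Real.exp (-K ω) := by
    intro ω; rw [← Real.exp_add]; congr 1; ring
  simp_rw [e]
  rw [integral_const_mul]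
  have hpos : 0 < ∫ ω, Real.exp (-K ω) ∂Measure.pi (fun _ : ι => μ) :=
    integral_exp_pos (integrable_pi_of_continuous μ (Real.continuous_exp.comp hK.neg))
  rw [Real.log_mul (Real.exp_pos m).ne' hpos.ne', Real.log_exp]

/-- **Each block term is nonnegative**: `0 ≤ ∫K dπ + log ∫e^{−K} dπ` (Jensen). -/
theorem integral_add_log_integral_exp_neg_nonneg {K : (ι → X) → ℝ} (hK : Continuous K) :
    0 ≤ (∫ ω, K ω ∂Measure.pi (fun _ : ι => μ)) +
        Real.log (∫ ω, Real.exp (-K ω) ∂Measure.pi (fun _ : ι => μ)) := by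
  -- `A_univ K ≡ ∫K`, so conditional Jensen with `s = univ` gives `e^{−∫K} ≤ ∫e^{−K}`
  have h := integral_exp_neg_coordAvg_le μ (Finset.univ : Finset ι) hK
  simp only [coordAvg_univ, integral_const, smul_eq_mul, probReal_univ, one_mul] at h
  have hpos : 0 < ∫ ω, Real.exp (-K ω) ∂Measure.pi (fun _ : ι => μ) :=
    integral_exp_pos (integrable_pi_of_continuous μ (Real.continuous_exp.comp hK.neg))
  have hlog := Real.log_le_log (Real.exp_pos _) h
  rw [Real.log_exp] at hlog
  linarith

/-- **THE BLOCK TENSORIZATION FLOOR (exact form).**  Blocks `B_j` (`j ∈ T`) pairwise disjoint,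
corridors `C`; `h_j` continuous depending only on `B_j ∪ C`, `r` continuous depending only on `C`.
Then for `F_loc = Σ_{j∈T} h_j + r`:
`Σ_{j∈T} (∫h_j dπ + log ∫e^{−A_C h_j} dπ) ≤ ∫F_loc dπ + log ∫e^{−F_loc} dπ` —
integrate out the corridors inside the exponent (conditional Jensen), after which the weight
factorizes over the independent blocks. -/
theorem sum_blocks_le_integral_add_log_integral_exp_neg {J : Type*} (T : Finset J) (B : J → Finset ι)
    (hB : ∀ j ∈ T, ∀ j' ∈ T, j ≠ j' → Disjoint (B j) (B j')) (C : Finset ι)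
    {h : J → (ι → X) → ℝ} (hc : ∀ j ∈ T, Continuous (h j))
    (hdep : ∀ j ∈ T, DependsOn (h j) (↑(B j) ∪ ↑C))
    {r : (ι → X) → ℝ} (hr : Continuous r) (hrC : DependsOn r ↑C) :
    ∑ j ∈ T, ((∫ ω, h j ω ∂Measure.pi (fun _ : ι => μ)) +
        Real.log (∫ ω, Real.exp (-coordAvg μ C (h j) ω) ∂Measure.pi (fun _ : ι => μ))) ≤
      (∫ ω, (∑ j ∈ T, h j ω + r ω) ∂Measure.pi (fun _ : ι => μ)) +
        Real.log (∫ ω, Real.exp (-(∑ j ∈ T, h j ω + r ω)) ∂Measure.pi (fun _ : ι => μ)) := by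
  set π : Measure (ι → X) := Measure.pi (fun _ : ι => μ) with hπ
  set rbar : ℝ := ∫ ω, r ω ∂π with hrbar
  have hsum_c : Continuous fun ω : ι → X => ∑ j ∈ T, h j ω := continuous_finsetSum T fun j hj => hc j hj
  have hFc : Continuous fun ω : ι → X => ∑ j ∈ T, h j ω + r ω := hsum_c.add hr
  -- (1) the mean of `F_loc`
  have hmean : ∫ ω, (∑ j ∈ T, h j ω + r ω) ∂π = ∑ j ∈ T, ∫ ω, h j ω ∂π + rbar := by
    have hi1 : Integrable (fun ω => ∑ j ∈ T, h j ω) π := integrable_pi_of_continuous μ hsum_c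
    have hi2 : Integrable r π := integrable_pi_of_continuous μ hr
    rw [integral_add hi1 hi2, integral_finsetSum T fun j hj => integrable_pi_of_continuous μ (hc j hj)]
  -- (2) the corridor average of `F_loc` splits into block functions plus the constant `rbar`
  have hAr : ∀ ω, coordAvg μ C r ω = rbar := fun ω =>
    coordAvg_eq_integral_of_dependsOn μ C hrC subset_rfl ω
  have hAF : ∀ ω, coordAvg μ C (fun ω => ∑ j ∈ T, h j ω + r ω) ω =
      ∑ j ∈ T, coordAvg μ C (h j) ω + rbar := by
    intro ω
    rw [coordAvg_add μ C hsum_c hr, coordAvg_finset_sum μ T C hc, hAr]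
  -- (3) conditional Jensen
  have hJ := integral_exp_neg_coordAvg_le μ C hFc
  rw [← hπ] at hJ
  have hfact : ∀ ω, Real.exp (-coordAvg μ C (fun ω => ∑ j ∈ T, h j ω + r ω) ω) =
      Real.exp (-rbar) * ∏ j ∈ T, Real.exp (-coordAvg μ C (h j) ω) := by
    intro ω
    rw [hAF ω, neg_add, Real.exp_add, mul_comm, ← Finset.sum_neg_distrib, Real.exp_sum]
  simp_rw [hfact] at hJ
  rw [integral_const_mul] at hJ
  -- (4) the block factors are independent
  have hkc : ∀ j ∈ T, Continuous fun ω : ι → X => Real.exp (-coordAvg μ C (h j) ω) :=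
    fun j hj => Real.continuous_exp.comp (continuous_coordAvg μ C (hc j hj)).neg
  have hkdep : ∀ j ∈ T, DependsOn (fun ω : ι → X => Real.exp (-coordAvg μ C (h j) ω)) ↑(B j) := by
    intro j hj ω₁ ω₂ hagree
    have hd := dependsOn_coordAvg μ C (hdep j hj)
    have : coordAvg μ C (h j) ω₁ = coordAvg μ C (h j) ω₂ := by
      apply hd
      intro i hi
      rcases hi with ⟨hi1, hi2⟩
      rcases hi1 with hiB | hiC
      · exact hagree i hiB
      · exact absurd hiC hi2
    simp only [this]
  have hprod := integral_finset_prod_eq_prod_integral μ T B hB hkc hkdep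
  rw [← hπ] at hprod
  rw [hprod] at hJ
  -- (5) positivity and logarithms
  have hZpos : ∀ j ∈ T, 0 < ∫ ω, Real.exp (-coordAvg μ C (h j) ω) ∂π :=
    fun j hj => integral_exp_pos (integrable_pi_of_continuous μ (hkc j hj))
  have hFpos : 0 < ∫ ω, Real.exp (-(∑ j ∈ T, h j ω + r ω)) ∂π :=
    integral_exp_pos (integrable_pi_of_continuous μ (Real.continuous_exp.comp hFc.neg))
  have hPpos : 0 < ∏ j ∈ T, ∫ ω, Real.exp (-coordAvg μ C (h j) ω) ∂π :=
    Finset.prod_pos fun j hj => hZpos j hj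
  have hlog : -rbar + ∑ j ∈ T, Real.log (∫ ω, Real.exp (-coordAvg μ C (h j) ω) ∂π) ≤
      Real.log (∫ ω, Real.exp (-(∑ j ∈ T, h j ω + r ω)) ∂π) := by
    have h1 := Real.log_le_log (mul_pos (Real.exp_pos _) hPpos) hJ
    rwa [Real.log_mul (Real.exp_pos _).ne' hPpos.ne', Real.log_exp,
      Real.log_prod (fun j hj => (hZpos j hj).ne')] at h1
  rw [hmean, Finset.sum_add_distrib]
  linarith

/-- **THE BLOCK TENSORIZATION FLOOR (approximate form).**  With the blocks, corridors, `h_j` and `r`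
as in `sum_blocks_le_integral_add_log_integral_exp_neg`, for every continuous `F` with
`|F − (Σ_{j∈T} h_j + r)| ≤ δ` pointwise:
`Σ_{j∈T} (∫h_j dπ + log ∫e^{−A_C h_j} dπ) − 2δ ≤ ∫F dπ + log ∫e^{−F} dπ` — the free energy
(reverse relative entropy `KL(π ‖ π.tilted(−F))`) of an approximately local log-weight is at least the
sum of its block free-energy fluctuations, up to twice the localization error. -/
theorem sum_blocks_sub_le_integral_add_log_integral_exp_neg {J : Type*} (T : Finset J)
    (B : J → Finset ι) (hB : ∀ j ∈ T, ∀ j' ∈ T, j ≠ j' → Disjoint (B j) (B j')) (C : Finset ι)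
    {h : J → (ι → X) → ℝ} (hc : ∀ j ∈ T, Continuous (h j))
    (hdep : ∀ j ∈ T, DependsOn (h j) (↑(B j) ∪ ↑C))
    {r : (ι → X) → ℝ} (hr : Continuous r) (hrC : DependsOn r ↑C)
    {F : (ι → X) → ℝ} (hF : Continuous F) {δ : ℝ}
    (hδ : ∀ ω, |F ω - (∑ j ∈ T, h j ω + r ω)| ≤ δ) :
    ∑ j ∈ T, ((∫ ω, h j ω ∂Measure.pi (fun _ : ι => μ)) +
        Real.log (∫ ω, Real.exp (-coordAvg μ C (h j) ω) ∂Measure.pi (fun _ : ι => μ))) - 2 * δ ≤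
      (∫ ω, F ω ∂Measure.pi (fun _ : ι => μ)) +
        Real.log (∫ ω, Real.exp (-F ω) ∂Measure.pi (fun _ : ι => μ)) := by
  set π : Measure (ι → X) := Measure.pi (fun _ : ι => μ) with hπ
  have hexact := sum_blocks_le_integral_add_log_integral_exp_neg μ T B hB C hc hdep hr hrC
  rw [← hπ] at hexact
  have hLc : Continuous fun ω : ι → X => ∑ j ∈ T, h j ω + r ω :=
    (continuous_finsetSum T fun j hj => hc j hj).add hr
  have hFi : Integrable F π := integrable_pi_of_continuous μ hF
  have hLi : Integrable (fun ω => ∑ j ∈ T, h j ω + r ω) π := integrable_pi_of_continuous μ hLc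
  -- means
  have hmean : (∫ ω, (∑ j ∈ T, h j ω + r ω) ∂π) - δ ≤ ∫ ω, F ω ∂π := by
    have h1 : ∫ ω, ((∑ j ∈ T, h j ω + r ω) - δ) ∂π ≤ ∫ ω, F ω ∂π :=
      integral_mono (hLi.sub (integrable_const δ)) hFi fun ω => by
        have := hδ ω; simp only; linarith [abs_le.1 this]
    have hδi : Integrable (fun _ : ι → X => δ) π := integrable_const δ
    rw [integral_sub hLi hδi, integral_const, smul_eq_mul, probReal_univ, one_mul] at h1
    exact h1
  -- exponential moments
  have hEF : Integrable (fun ω => Real.exp (-F ω)) π :=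
    integrable_pi_of_continuous μ (Real.continuous_exp.comp hF.neg)
  have hEL : Integrable (fun ω => Real.exp (-δ) * Real.exp (-(∑ j ∈ T, h j ω + r ω))) π :=
    (integrable_pi_of_continuous μ (Real.continuous_exp.comp hLc.neg)).const_mul _
  have hexp : Real.exp (-δ) * ∫ ω, Real.exp (-(∑ j ∈ T, h j ω + r ω)) ∂π ≤
      ∫ ω, Real.exp (-F ω) ∂π := by
    rw [← integral_const_mul]
    refine integral_mono hEL hEF fun ω => ?_
    have := hδ ω
    simp only
    rw [← Real.exp_add]
    exact Real.exp_le_exp.2 (by linarith [abs_le.1 this])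
  have hLpos : 0 < ∫ ω, Real.exp (-(∑ j ∈ T, h j ω + r ω)) ∂π :=
    integral_exp_pos (integrable_pi_of_continuous μ (Real.continuous_exp.comp hLc.neg))
  have hlog : -δ + Real.log (∫ ω, Real.exp (-(∑ j ∈ T, h j ω + r ω)) ∂π) ≤
      Real.log (∫ ω, Real.exp (-F ω) ∂π) := by
    have h1 := Real.log_le_log (mul_pos (Real.exp_pos _) hLpos) hexp
    rwa [Real.log_mul (Real.exp_pos _).ne' hLpos.ne', Real.log_exp] at h1
  linarith

end Floor

end Summit.Ventures.LatticeQCDFlow.Exactness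

end
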